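import Literature.GroupTheory.SpecificGroups.FiniteUnitaryThreeUnipotentJordanClasses   -- ★ p845492: unipotent classes of `U₃(𝔽_q)` by Jordan rank (`exists_conj_eq_of_rank_sub_one_eq_of_hermitian`)
import Literature.LinearAlgebra.Matrix.UnitaryFormAdjointCayley                          -- ★ form adjoint `θ_J`: `formAdjoint_add∕sub∕mul∕one`, `exists_mem_unitaryGroupOfForm_coe_eq`
import HarnessLib

/-!
# Nilpotent `Ad U₃(𝔽_q)`-orbits in `Lie U₃(𝔽_q)` are classified by the rank (`q` odd): the additive twin of «Jordan rank classifies the unipotent classes of `U₃(𝔽_q)`»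

Topic `Literature/GroupTheory/SpecificGroups`; namespace `Literature.GroupTheory.SpecificGroups`.  THEOREMS ONLY (no definition, no named fact, no instance, no notation,
no `sorry`).  Road «S3-tree» of cell `pub/hodgecm-mathlib` (crux H413 = `stmt-HodgeConjecture-24833`), organ (V)-INT of the END fold `stub_liftValues` (architect A-p16 (g30)
A-130 (1); seat F0P3-p03 (g14)): a level-2 `K`-class piece on the hyperspecial `K = U(H′)(𝒪_v)` is constant on the strata of `K(1)⧸K(2) ≅ Lie U(J̄)(𝔽_q)` cut out by the
rank of the residual nilpotent, because — the fact typed here — **in `Lie U(σ, J) = {N ∈ M₃(𝔽_{q²}) : J⁻¹ σ(N)ᵀ J = −N}` (`σ = Frob_q`, `J` non-degenerate `σ`-hermitian,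
`2 ≠ 0`) two nilpotent elements with the same rank are `Ad U(σ, J)`-conjugate** (three orbits: `0`, rank `1`, rank `2` = regular nilpotent).  Over `𝔽̄_q` this is the Jordan
type; rationality of the orbits is usually quoted from Lang's theorem (connected centralisers).  HERE it is deduced from the GROUP statement ★ p845492
`exists_conj_eq_of_rank_sub_one_eq_of_hermitian` by the truncated CAYLEY map `W(N) = 1 − 2N + 2N²` (`= (1 − N)(1 + N)⁻¹` for `N³ = 0`, [Weyl1939, Ch. II §10]; the
tree's ★ `cayley_mem_unitaryGroupOfForm` is the same map for general `N`): `θ_J(W(N))·W(N) = 1 + 4N⁴ = 1`, so `W(N) ∈ U(σ, J)`; `W(N) − 1 = N·2(N − 1)` is nilpotent of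
rank `rank N`; `W(gNg⁻¹) = g W(N) g⁻¹`; and `W` is injective on cube-zero matrices when `2 ≠ 0` (`W − 1 = 2(N² − N)`, `(N² − N)² = N²`, `N = N² − (N² − N)`).
HONEST LABEL: HC_CM is proved only modulo the printed citations (the 2 remaining named inputs hLiu418, h413) until rung 0 closes; this file is elementary linear algebra
over a finite field and asserts nothing printed about the `p`-adic `U(3)`.

THE PRINT. [Rogawski1990, §3.9 p. 32, Prop. 3.9.1]: «The set of regular unipotent elements in `U(3)` consists of a single conjugacy class» (and the singular ones are
classified by `t mod NE^*`, one class over a finite field); [Weyl1939, Ch. II §10]: Cayley's rational parametrisation `S ↦ (1 − S)(1 + S)⁻¹` of the unitary ∕ orthogonal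
group by its infinitesimal (anti-hermitian) elements, equivariant for conjugation.

* `eq_of_truncCayley_eq` — injectivity of `W` on `{N : N³ = 0}` (`2 ≠ 0`);
* **`exists_unitary_conj_eq_of_pow_three_eq_zero_of_rank_eq`** — MAIN: `N, N′ ∈ Lie U(σ, J)`, `N³ = N′³ = 0`, `rank N = rank N′` ⇒ `∃ g ∈ U(σ, J)`, `g N g⁻¹ = N′`.

## References
* [Rogawski1990] J. D. Rogawski, *Automorphic Representations of Unitary Groups in Three Variables*, Ann. of Math. Stud. 123 (1990): §3.9 p. 32, Proposition 3.9.1.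
* [Weyl1939] H. Weyl, *The Classical Groups*, Princeton (1939): Ch. II §10.
* [Wilson2009] R. A. Wilson, *The Finite Simple Groups*, GTM 251 (2009): §3.6.1 p. 67.
-/

set_option autoImplicit false

noncomputable section

open Matrix Literature.NumberTheory.Automorphic Literature.LinearAlgebra.Matrix

namespace Literature.GroupTheory.SpecificGroups

section FiniteLie

variable {k : Type*} [Field k]

/-- The truncated Cayley polynomial `W(N) = 1 − 2N + 2N²` of a cube-zero matrix determines `N`: `W(M) = W(N)`, `M³ = N³ = 0`, `2 ≠ 0` ⇒ `M = N`
(`W − 1 = 2(N² − N)` and `(N² − N)² = N²`). [cite: Weyl1939, Ch. II §10] -/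
theorem eq_of_truncCayley_eq (h2 : (2 : k) ≠ 0) {M N : Matrix (Fin 3) (Fin 3) k} (hM : M * M * M = 0) (hN : N * N * N = 0)
    (h : 1 - (M + M) + (M + M) * M = 1 - (N + N) + (N + N) * N) : M = N := by
  have hA : M * M - M = N * N - N := by
    have h' : (2 : k) • (M * M - M) = (2 : k) • (N * N - N) := by
      rw [two_smul, two_smul]
      have e1 : M * M - M + (M * M - M) = (1 - (M + M) + (M + M) * M) - 1 := by noncomm_ring
      have e2 : N * N - N + (N * N - N) = (1 - (N + N) + (N + N) * N) - 1 := by noncomm_ring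
      rw [e1, e2, h]
    exact smul_right_injective _ h2 h'
  have hsqM : (M * M - M) * (M * M - M) = M * M := by
    have e : (M * M - M) * (M * M - M) = M * M * M * M - M * M * M - M * M * M + M * M := by noncomm_ring
    rw [e, hM, Matrix.zero_mul, sub_zero, sub_zero, zero_add]
  have hsqN : (N * N - N) * (N * N - N) = N * N := by
    have e : (N * N - N) * (N * N - N) = N * N * N * N - N * N * N - N * N * N + N * N := by noncomm_ring
    rw [e, hN, Matrix.zero_mul, sub_zero, sub_zero, zero_add]
  have hsq : M * M = N * N := by rw [← hsqM, hA, hsqN]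
  calc M = M * M - (M * M - M) := by abel
    _ = N * N - (N * N - N) := by rw [hA, hsq]
    _ = N := by abel

variable [Fintype k] {q : ℕ}

/-- **Nilpotent `Ad U(σ, J)`-orbits in `Lie U(σ, J) ⊂ M₃(𝔽_{q²})` are classified by the rank** (additive twin of ★ `exists_conj_eq_of_rank_sub_one_eq_of_hermitian`):
`N, N′` anti-hermitian (`J⁻¹ σ(N)ᵀ J = −N`), `N³ = N′³ = 0`, `rank N = rank N′` ⇒ `g N g⁻¹ = N′` for some `g ∈ U(σ, J)`.  Transport through the truncated Cayley map
`N ↦ W(N) = 1 − 2N + 2N²` (`= (1 − N)(1 + N)⁻¹`): `W(N) ∈ U(σ, J)` is unipotent with `rank(W(N) − 1) = rank N`, `W` is `Ad`-equivariant and injective (`2 ≠ 0`).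
[cite: Rogawski1990, §3.9 p. 32, Prop. 3.9.1] [cite: Weyl1939, Ch. II §10] -/
theorem exists_unitary_conj_eq_of_pow_three_eq_zero_of_rank_eq (hk : Fintype.card k = q ^ 2) (σ : k →+* k) (hσ : ∀ x, σ x = x ^ q) (h2 : (2 : k) ≠ 0)
    {J : Matrix (Fin 3) (Fin 3) k} (hJ : (J.map σ)ᵀ = J) (hdet : J.det ≠ 0)
    {N N' : Matrix (Fin 3) (Fin 3) k} (hN : J⁻¹ * (N.map σ)ᵀ * J = -N) (hN' : J⁻¹ * (N'.map σ)ᵀ * J = -N')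
    (hnil : N ^ 3 = 0) (hnil' : N' ^ 3 = 0) (hrank : N.rank = N'.rank) :
    ∃ g : GL (Fin 3) k, g ∈ unitaryGroupOfForm σ J ∧ (g : Matrix (Fin 3) (Fin 3) k) * N * ((g⁻¹ : GL (Fin 3) k) : Matrix (Fin 3) (Fin 3) k) = N' := by
  have hJu : IsUnit J.det := isUnit_iff_ne_zero.2 hdet
  have hN3 : N * N * N = 0 := by rw [← hnil, pow_succ, pow_two]
  have hN3' : N' * N' * N' = 0 := by rw [← hnil', pow_succ, pow_two]
  -- the truncated Cayley value `W(X) = 1 − 2X + 2X²` is unitary, unipotent, with `rank(W − 1) = rank X`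
  have key : ∀ {X : Matrix (Fin 3) (Fin 3) k}, J⁻¹ * (X.map σ)ᵀ * J = -X → X * X * X = 0 →
      ∃ u : GL (Fin 3) k, u ∈ unitaryGroupOfForm σ J ∧ (u : Matrix (Fin 3) (Fin 3) k) = 1 - (X + X) + (X + X) * X ∧
        IsNilpotent ((u : Matrix (Fin 3) (Fin 3) k) - 1) ∧ ((u : Matrix (Fin 3) (Fin 3) k) - 1).rank = X.rank := by
    intro X hX hX3
    have hθ : J⁻¹ * ((1 - (X + X) + (X + X) * X).map σ)ᵀ * J = 1 + (X + X) + X * (X + X) := by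
      rw [formAdjoint_add, formAdjoint_sub, formAdjoint_one σ hJu, formAdjoint_mul σ hJu, formAdjoint_add, hX]
      noncomm_ring
    have hW : J⁻¹ * ((1 - (X + X) + (X + X) * X).map σ)ᵀ * J * (1 - (X + X) + (X + X) * X) = 1 := by
      rw [hθ]
      have e : (1 + (X + X) + X * (X + X)) * (1 - (X + X) + (X + X) * X) = 1 + 4 • (X * X * X * X) := by noncomm_ring
      rw [e, hX3, Matrix.zero_mul, smul_zero, add_zero]
    obtain ⟨u, hu, huW⟩ := exists_mem_unitaryGroupOfForm_coe_eq σ hJu hW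
    have hu1 : (u : Matrix (Fin 3) (Fin 3) k) - 1 = X * ((2 : k) • (X - 1)) := by
      rw [huW, Matrix.mul_smul, two_smul]; noncomm_ring
    have hcomm : Commute X ((2 : k) • (X - 1)) := ((Commute.refl X).sub_right (Commute.one_right X)).smul_right _
    have hXnil : IsNilpotent X := ⟨3, by rw [pow_succ, pow_two, hX3]⟩
    have hPu : IsUnit ((2 : k) • (X - 1)).det := by
      rw [Matrix.det_smul, Fintype.card_fin]
      refine (IsUnit.pow _ (isUnit_iff_ne_zero.2 h2)).mul ?_
      rw [← Matrix.isUnit_iff_isUnit_det]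
      have h1 : X - 1 = -(1 - X) := by abel
      rw [h1]
      exact hXnil.isUnit_one_sub.neg
    refine ⟨u, hu, huW, ?_, ?_⟩
    · rw [hu1]; exact hcomm.isNilpotent_mul_right hXnil
    · rw [hu1]; exact Matrix.rank_mul_eq_left_of_isUnit_det _ _ hPu
  obtain ⟨u, hu, huW, hun, hur⟩ := key hN hN3
  obtain ⟨u', hu', huW', hun', hur'⟩ := key hN' hN3'
  obtain ⟨g, hg, hconj⟩ := exists_conj_eq_of_rank_sub_one_eq_of_hermitian hk σ hσ h2 hJ hdet hu hu' hun hun' (by rw [hur, hur', hrank])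
  refine ⟨g, hg, ?_⟩
  -- `W` is `Ad`-equivariant and injective on cube-zero matrices
  set G : Matrix (Fin 3) (Fin 3) k := (g : Matrix (Fin 3) (Fin 3) k) with hGdef
  set Gi : Matrix (Fin 3) (Fin 3) k := ((g⁻¹ : GL (Fin 3) k) : Matrix (Fin 3) (Fin 3) k) with hGidef
  have hGiG : Gi * G = 1 := by rw [hGdef, hGidef, ← Units.val_mul, inv_mul_cancel, Units.val_one]
  have hGGi : G * Gi = 1 := by rw [hGdef, hGidef, ← Units.val_mul, mul_inv_cancel, Units.val_one]
  have hM2 : G * N * Gi * (G * N * Gi) = G * (N * N) * Gi := by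
    calc G * N * Gi * (G * N * Gi) = G * N * (Gi * G) * N * Gi := by simp only [Matrix.mul_assoc]
      _ = G * (N * N) * Gi := by rw [hGiG, Matrix.mul_one, Matrix.mul_assoc G N N]
  have hM3 : G * N * Gi * (G * N * Gi) * (G * N * Gi) = 0 := by
    rw [hM2]
    calc G * (N * N) * Gi * (G * N * Gi) = G * (N * N) * (Gi * G) * N * Gi := by simp only [Matrix.mul_assoc]
      _ = 0 := by rw [hGiG, Matrix.mul_one, Matrix.mul_assoc G (N * N) N, hN3, Matrix.mul_zero, Matrix.zero_mul]
  have hWconj : G * (1 - (N + N) + (N + N) * N) * Gi = 1 - (G * N * Gi + G * N * Gi) + (G * N * Gi + G * N * Gi) * (G * N * Gi) := by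
    have e : (G * N * Gi + G * N * Gi) * (G * N * Gi) = G * N * Gi * (G * N * Gi) + G * N * Gi * (G * N * Gi) := by noncomm_ring
    rw [e, hM2]
    have e2 : G * (1 - (N + N) + (N + N) * N) * Gi = G * Gi - (G * N * Gi + G * N * Gi) + (G * (N * N) * Gi + G * (N * N) * Gi) := by noncomm_ring
    rw [e2, hGGi]
  have hc : (((g * u * g⁻¹ : GL (Fin 3) k)) : Matrix (Fin 3) (Fin 3) k) = (u' : Matrix (Fin 3) (Fin 3) k) := by rw [hconj]
  rw [Units.val_mul, Units.val_mul, huW, huW', ← hGdef, ← hGidef, hWconj] at hc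
  exact eq_of_truncCayley_eq h2 hM3 hN3' hc

end FiniteLie

end Literature.GroupTheory.SpecificGroups

end
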